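import Literature.MathematicalPhysics.QuantumFieldTheory.Balaban1983to89.B9Eq37Insertion
import Literature.MathematicalPhysics.QuantumFieldTheory.Balaban1983to89.B12Membership314

/-!
# `Balaban1983to89.B9Eq39Adjoint` — the ADJOINTNESS FORMULAS (3.8)/(3.9) with an EXACT background and the lattice
# assembly (3.7) → (3.10), (3.11), (3.12) of B9 p. 392, kernel-checked; v1

CITATION HEADER (lean-in-tree rule).  Audit cell `pub-balaban`, surge node-prover lineage pv27 (B9 pp. 390–392), unit
`b2b-balaban-pv27-g15` (journal CLAIM l.52297).  Source: T. Bałaban, *Propagators for lattice gauge theories in a background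
field*, Commun. Math. Phys. **99** (1985) 389–434 [Balaban1985BackgroundPropagators] (cell paper B9; journal page = PDF page
+ 388), pp. 390–392 [PDF 2–4], quoted from the page renders `b2b-balaban-ref1/pages/1985-cmp99-background-propagators/…-p002-x2.png`,
`…-p003-x2.png`, `…-p004-x2.png` READ AS IMAGES by this seat (2026-08-19).

HONEST FRAMING (cell charter, verbatim in substance).  The cell audits Bałaban's papers; discharging its end statements would
make Bałaban's ultraviolet stability theorem unconditional inside this package — a constructive-QFT statement; it is NOT the
continuum limit and NOT the Clay problem.  THIS FILE DISCHARGES NOTHING of the series: it is finite non-commutative algebra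
(summation by parts over a finite set of sites with bijective shifts, trace cyclicity) on top of the lineage leaf
`B9Eq37Insertion` (the per-plaquette (3.7), imported BY NAME), certifying the two printed adjointness formulas (3.8), (3.9) —
quoted twice in the tree (`B8CurlGradHolonomy`, `B8HessianSupWitness` headers), never checked — and the rewriting (3.7) →
(3.10)/(3.11)/(3.12) they justify, with the background kept EXACT (arbitrary units, all orders).  Value = kernel certificate of
located printed identities + typed objects (`D*`, `J`, `⟨A,Δ′A⟩`) consumers can import; NOT summit progress.

ABSOLUTE RULE.  No internally-minted statement enters as a cited fact.  Every declaration below is PROVED (tags `[folklore]`);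
the `[cite: …]` tags document WHICH PRINTED DISPLAY a definition or a proved statement transcribes — the proofs are ours, the
print is not used as a hypothesis anywhere.

WHAT IS IN PRINT (context; «…» verbatim from the renders).
* p. 390 [PDF 2] (3.1): «A^η(U′U₀) = Σ_{p⊂T_η} η^{d−4}[1 − Re tr(U′U₀)(∂p)],  tr(U′U₀)(∂p) = tr(∂₀U′)((p)_z)U₀(∂p), where for a
  plaquette p = ⟨x, y, z, w⟩ we define (p)_z = ⟨z, w, x, y⟩, and (∂₀U′)((p)_z) = R(U₀(x,w))U′(z,w)U′(w,x)U′(x,y)R(U₀(x,y))U′(y,z).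
  Let us recall that R(U)X = UXU⁻¹.»; «We take U = U′U₀, U′ = exp iηA»; under (3.2): «where A′(b) are defined for bonds
  b ⊂ ∂(p)_z by the equalities A′(z,w) = R(U₀(x,w))A(z,w), A′(w,x) = A(w,x), A′(x,y) = A(x,y), A′(y,z) = R(U₀(x,y))·A(y,z), and ≺
  denotes a natural ordering among bonds of the oriented contour ∂(p)_z = ⟨z,w⟩∪⟨w,x⟩∪⟨x,y⟩∪⟨y,z⟩.»; «Let us introduce covariant
  derivatives. For a matrix valued function A defined at points of the lattice we put (D^η_{U₀}A)(b) = η⁻¹(R(U₀(b))A(b₊) − A(b₋)),»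
* p. 391 [PDF 3]: «or (D^η_{U₀,μ}A)(x) = (D^η_{U₀}A)(x, x + ηe_μ), μ = 1, …, d. (3.3)  For a function A defined at bonds of the
  lattice we put (D^η_{U₀}A)(p) = η⁻¹(A(x,y) + R(U₀(x,y))A(y,z) + R(U₀(x,w))A(z,w) + A(w,x)) (3.4) for a plaquette p = ⟨x, y, z, w⟩,
  and if p = p_{μν}(x) = ⟨x, x + ηe_μ, x + ηe_μ + ηe_ν, x + ηe_ν⟩, then we have (D^η_{U₀}A)(p_{μν}(x)) = (D^η_{U₀}A)_{μν}(x)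
  = (D^η_{U₀,μ}A_ν)(x) − (D^η_{U₀,ν}A_μ)(x). We have made here the identification A(x, x + ηe_μ) = A_μ(x).»; «We always make this
  assumption about gauge field configurations, i.e., U(x,x′) = U⁻¹(x′,x), A(x,x′) = −A(x′,x) for a bond ⟨x,x′⟩. (3.5)»; (3.7) and
  the complexified «Re U₀(∂p) = ½(U₀(∂p) + U₀(−∂p)), Im U₀(∂p) = (1/2i)(U₀(∂p) − U₀(−∂p))» — see the header of `B9Eq37Insertion`;
  «Let us also drop the symbols η, U in the symbols denoting covariant derivatives, thus we write simply D, D_μ. In the sequel we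
  will frequently use adjoint operators to derivatives D. The adjoints are taken with respect to natural L² scalar products for
  functions with values in N × N hermitian matrices. The inner product for these matrices is defined»
* p. 392 [PDF 4]: «by X·Y = tr XY. Let us recall that the trace is normalized, i.e., tr 1 = 1. For example, for derivative D
  acting on functions defined at points of the lattice, the adjoint operator D* is acting on functions A defined at bonds of
  the lattice by the formulas (D*A)(x) = Σ_{μ=1}^d η⁻¹(R(U(x, x − ηe_μ))A(x − ηe_μ, x) − A(x, x + ηe_μ)) = Σ_{μ=1}^d (D*_μ A_μ)(x)
  = Σ_{μ=1}^d (DA_μ)(x, x − ηe_μ). (3.8)  The operator adjoint to derivative D, acting on functions defined at bonds, is the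
  operator acting on functions F defined at plaquetts by the formula (D*F)(x, x + ηe_μ) = (D*F)_μ(x) = Σ_{ν<μ}(D*_ν F_{νμ})(x)
  − Σ_{ν>μ}(D*_ν F_{μν})(x) = Σ_{ν=1}^d (D*_ν F_{νμ})(x), (3.9) where F_{μν}(x) = F(p_{μν}(x)), and in the last equality above we
  have assumed that F_{μν}(x) = −F_{νμ}(x).  The quadratic terms in the expansion (3.7) define the basic operator generalizing
  the operator ∂*∂ in the Abelian case. We denote it by Δ^η(U), or simply by Δ. For U with values in the unitary group U(N) it
  is a hermitian operator given by the quadratic form ⟨A,ΔA⟩ = ⟨A,D*DA⟩ + ⟨A,Δ′A⟩, ⟨A,Δ′A⟩ = Σ_{p⊂T_η} η^d tr((D¹_U A)(p))²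
  η⁻²(Re U(∂p) − 1) + tr Σ_{b₁,b₂⊂∂(p)_z, b₁≺b₂} i[A′(b₁), A′(b₂)]η⁻² Im U(∂p). (3.10)  We have written it this way because with
  our assumptions on the configuration U the operator Δ′ will be a bounded, small operator, which will be treated as a small
  perturbation of D*D.  Let us write the linear term in (3.7) as ⟨A,J⟩ = Σ_{b⊂T_η} η^d tr A(b)J(b), (3.11) where J = D*η⁻² Im ∂U,
  (∂U)(p) = U(∂p). The expansion (3.7) can be written now as A^η(exp iηAU) = A^η(U) + ⟨A,J⟩ + ½⟨A,ΔA⟩ + ⋯. (3.12)»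

WHAT THIS FILE PROVES.  MODEL: `𝔸` a ring (§§1–4; a ℂ-algebra in §5, a complete normed ℂ-algebra in §6), `R U X = U·X·U⁻¹`
for a unit `U : 𝔸ˣ`; the lattice is a type of sites `S` (finite where sums occur) with, for each direction `μ : ι` (`ι` finite,
linearly ordered — the «μ = 1, …, d»), a BIJECTION `T μ : S ≃ S` («x ↦ x + ηe_μ»; NO commutation of the shifts is assumed or
needed); a configuration is `U : ι → S → 𝔸ˣ`, `U μ x = U(x, x+ηe_μ)` on positive bonds, (3.5) on the reversed ones; `τ` is any
ADDITIVE map with `τ(ab) = τ(ba)` into an additive commutative group (the «tr»; ℂ-linear in §§5–6).  The operators are typed at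
`η = 1` (§2) and the printed powers of `η` are restored as scalar factors in §5 (`curlη = η⁻¹·curl`, `divPη = η⁻¹·divP`,
`bondPair` with its `η^d`).
* §1 `R` and TRACE CYCLICITY: `τ(R(U)X·Y) = τ(X·R(U⁻¹)Y)` (`trace_R_mul`) — the one algebraic input.
* §2 THE OPERATORS, transcribed: `covD` = (3.3) `(D_μ f)(x) = R(U(x,x+e_μ))f(x+e_μ) − f(x)`; `covDstar` = the `D*_μ` of (3.8),
  `(D*_μ G)(x) = R(U(x,x−e_μ))G(x−e_μ) − G(x)` with `U(x,x−e_μ) = U(x−e_μ,x)⁻¹` (3.5) — the covariant derivative along the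
  REVERSED bond («= Σ_μ (DA_μ)(x, x−ηe_μ)»); `curl` = (3.4) `(D_U A)_{μν}(x) = (D_μA_ν)(x) − (D_νA_μ)(x)`; `divB` = (3.8) `(D*A)(x)
  = Σ_μ(D*_μA_μ)(x)`; `divP` = (3.9) FIRST FORM `(D*F)_μ(x) = Σ_{ν<μ}(D*_νF_{νμ})(x) − Σ_{ν>μ}(D*_νF_{μν})(x)`; `plaqU` = `U(∂p)`
  for `p = p_{μν}(x)`; `lettersA` = the four `A′(b)`, `b ⊂ ∂(p)_z`, of (3.2) with (3.5), in contour order; and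
  `sum_lettersA : Σ_b A′(b) = (D¹_U A)(p)` ((3.4)'s two forms agree); (3.9) LAST FORM `divP F μ x = Σ_ν (D*_ν F_{νμ})(x)` for
  `F_{νμ} = −F_{μν}`, `F_{μμ} = 0` (`divP_eq_sum_of_antisymm`; over ℂ antisymmetry alone suffices, `divP_eq_sum_of_antisymm'`;
  automatic for `F = D_U A`, `divP_curl`).
* §3 THE ADJOINTNESS IDENTITIES, exact background: `Σ_x τ((D_μ f)(x)G(x)) = Σ_x τ(f(x)(D*_μ G)(x))` (`sum_covD_mul`, one
  direction: reindex over the bijection `T μ`, move `R` by `trace_R_mul`); **(3.8)** `Σ_xΣ_μ τ((D_μ f)(x)A_μ(x)) = Σ_x τ(f(x)(D*A)(x))`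
  (`sum_sum_covD_mul`); **(3.9)** `Σ_xΣ_{μ<ν} τ((D_U A)_{μν}(x)F_{μν}(x)) = Σ_xΣ_μ τ(A_μ(x)(D*F)_μ(x))` (`sum_curl_mul`; with the last
  form, `sum_curl_mul_antisymm`); and the `D*D` form of (3.10), `Σ_b τ(A(b)(D*D_U A)(b)) = Σ_p τ(((D_U A)(p))²)` (`sum_mul_divP_curl`).
* §4 `posPlaq S ι` = the positively oriented plaquettes `(x, μ, ν)`, `μ < ν` («Σ_{p⊂T_η}»); (3.9) over it (`sum_posPlaq_curl_mul`).
* §5 (`[Algebra ℂ 𝔸]`, `τ : 𝔸 →ₗ[ℂ] ℂ` tracial) THE PRINTED WEIGHTS: `⟨A, D^{η*}F⟩ = Σ_{p⊂T_η} η^d τ((D^η_U A)(p)F(p))`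
  (`bondPair_divPη`: the `η⁻¹` of `D^η` and of `D^{η*}` match); `J := D^{η*}(η⁻² imC ∂U)` (3.11) and
  `⟨A,J⟩ = Σ_p η^d τ((D^η_U A)(p)·η⁻² Im U(∂p))` = the FIRST-ORDER TERM of (3.7) (`bondPair_J`);
  `⟨A, D^{η*}D^η_U A⟩ = Σ_p η^d τ(((D^η_U A)(p))²)` (`bondPair_divPη_curlη`).
* §6 (complete normed ℂ-algebra) THE ASSEMBLY: `deltaPrime` = `⟨A,Δ′A⟩` of (3.10) LETTER FOR LETTER (complexified `Re`, `Im`;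
  `Σ_{b₁≺b₂}[A′(b₁),A′(b₂)] = commSum [A′(b)]`; the `η^d` on both terms as in the bracket of (3.7)), `hessPair` = `⟨A,ΔA⟩ =
  ⟨A,D*D_UA⟩ + ⟨A,Δ′A⟩` (3.10), `action` = (3.1) in the complexified reading (`Σ_p η^{d−4} wil τ U(∂p)`, `B9Eq37Insertion.wil`);
  `summand_split`: the (3.7) summand of ONE plaquette (`B9Eq37Insertion.eq37_summand_dim` BY NAME, `X = η⁻¹Σ_bA′(b) = (D^η_UA)(p)` by
  `plaqD_lettersA`) splits as `η^dτ(X·η⁻²Im W) + ½[η^dτ(X²) + η^d(τ((D¹A)²η⁻²(Re W − 1)) + τ(iC·η⁻²Im W))] + η^{d−4}ρ_p`;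
  **`eq312_letters`**: summed over `posPlaq`, `Σ_p η^{d−4}(wil τ((∂₀U′)((p)_z)·U₀(∂p)) − wil τ U₀(∂p)) = ⟨A,J⟩ + ½⟨A,ΔA⟩ +
  η^{d−4}Σ_pρ_p` — (3.9) turns the first-order term into `⟨A,J⟩` and the `τ(X²)` term into `⟨A,D*D_UA⟩`; `norm_rem3_le`:
  `‖ρ_p‖ ≤ ½‖τ‖(‖U₀(∂p)‖ + ‖U₀(∂p)⁻¹‖)·expTail 3 (|η|Σ_b‖A′(b)‖)` (third order; `B9Eq37Insertion.norm_rem_le` BY NAME);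
  `wil_plaqU_prodCfg`: (3.1) for the plaquette variable — with `U′(b) = exp iηA(b)` (`fluct`) and `U = U′U₀` on positive bonds
  (`prodCfg`), `wil τ((U′U₀)(∂p)) = wil τ((∂₀U′)((p)_z)·U₀(∂p))` (conjugation through `exp` = `B12Membership314.exp_units_conj'` BY
  NAME, then `wil τ(XY) = wil τ(YX)`); **`eq312`**: (3.12) `A^η(U′U₀) = A^η(U₀) + ⟨A,J⟩ + ½⟨A,ΔA⟩ + η^{d−4}Σ_pρ_p` on any finite
  lattice, background arbitrary units (no smallness, no unitarity), `η ≠ 0`, `d ≥ 4`.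
* §7 sanity examples (trivial background: plain forward/backward differences; one direction: no plaquettes).

RELATED IN THE TREE, NOT DUPLICATED (searched 2026-08-19: `grep -rn "(3.9)\|adjoint" Balaban1983to89/`, MODULE-MAP rows B8/B9/β):
`B8CurlGradHolonomy` types `covD`/`covCurl` for a monoid ACTION and proves curl∘grad = holonomy defect (its header QUOTES (3.8)/(3.9),
proves no adjointness); `B8HessianSupWitness` quotes (3.9) in a docstring only; `B9Thm37Glue` §5 (`covDT`, `sum_covDT_mul`) is the
SITE-level (3.8) in a real-component toy model (`Fin n → ℝ`, transport as a real matrix), not the plaquette adjoint (3.9) and not over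
a non-commutative algebra; the β sub-cell (`Beta.PlaquetteVertex`, `Beta.Weitzenbock`, `Beta.PlaquetteBackground`, `Beta.PlaquetteStencil`,
`Beta.LogDetVariation`) expands the background `U₀ = e^B` to FIRST order in `B` (graded jets), whereas here `U₀(b)` are arbitrary
units kept exact; `B9Eq37Insertion` (this lineage) is the per-plaquette (3.7) used BY NAME; `B12Membership314.plaquette_mul_background`
is (3.1) at the level of words, first order — its `exp_units_conj'` is used BY NAME.  None types `D*` on plaquette functions,
proves (3.8)/(3.9) as adjointness identities with transport by units, or assembles (3.10)–(3.12) on a lattice.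

NOT PROVED HERE, NOT CLAIMED: anything about `Δ^η(U)` as an OPERATOR (hermiticity on `U(N)`, positivity of `D*D`, the smallness of
`Δ′` «with our assumptions on the configuration U»), the propagators, the averaging operators (3.13)ff, or any theorem of the series;
the identification of the abstract `(S, T, ι)` with the torus `T_η` and of `τ` with the normalized matrix trace is the reader's
(DIVERGENCE D-pv27.4: unit lattice + scalar `η`-factors, abstract tracial `τ`, complexified `Re`/`Im` as on p. 391, `F_{μμ} = 0`
explicit over a general ring).  Records: GAPS C-pv27-68.  NOT summit progress.
-/

noncomputable section

open NormedSpace Complex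

namespace Literature.MathematicalPhysics.QuantumFieldTheory.Balaban1983to89.B9Eq39Adjoint

open Literature.MathematicalPhysics.QuantumFieldTheory.Balaban1983to89.Beta.TransportVertices
open Literature.MathematicalPhysics.QuantumFieldTheory.Balaban1983to89.Beta.AdjointTransportJets
open Literature.MathematicalPhysics.QuantumFieldTheory.Balaban1983to89.B9Eq37Insertion

/-! ## §1  Transport by a unit, `R(U)X = UXU⁻¹`, and trace cyclicity -/

section Transport

variable {𝔸 : Type*} [Ring 𝔸]

/-- «R(U)X = UXU⁻¹» (B9 p. 390): conjugation of an algebra element by a unit. [folklore]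
[cite: Balaban1985BackgroundPropagators, p.390] -/
def R (U : 𝔸ˣ) (X : 𝔸) : 𝔸 := (U : 𝔸) * X * ((U⁻¹ : 𝔸ˣ) : 𝔸)

/-- Unfolding `R`. [folklore] -/
theorem R_def (U : 𝔸ˣ) (X : 𝔸) : R U X = (U : 𝔸) * X * ((U⁻¹ : 𝔸ˣ) : 𝔸) := rfl

/-- `R(U)` is additive. [folklore] -/
theorem R_add (U : 𝔸ˣ) (X Y : 𝔸) : R U (X + Y) = R U X + R U Y := by
  simp only [R, mul_add, add_mul]

/-- `R(U)(X − Y) = R(U)X − R(U)Y`. [folklore] -/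
theorem R_sub (U : 𝔸ˣ) (X Y : 𝔸) : R U (X - Y) = R U X - R U Y := by
  simp only [R, mul_sub, sub_mul]

/-- `R(U)(−X) = −R(U)X`. [folklore] -/
theorem R_neg (U : 𝔸ˣ) (X : 𝔸) : R U (-X) = -R U X := by
  simp only [R, mul_neg, neg_mul]

/-- `R(U)0 = 0`. [folklore] -/
@[simp] theorem R_zero (U : 𝔸ˣ) : R U (0 : 𝔸) = 0 := by
  simp [R]

/-- `R(1)X = X`. [folklore] -/
@[simp] theorem R_one (X : 𝔸) : R (1 : 𝔸ˣ) X = X := by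
  simp [R]

/-- `R(U)1 = 1`. [folklore] -/
@[simp] theorem R_apply_one (U : 𝔸ˣ) : R U (1 : 𝔸) = 1 := by
  simp [R]

/-- `R(UV) = R(U)R(V)` (a representation). [folklore] -/
theorem R_mul (U V : 𝔸ˣ) (X : 𝔸) : R (U * V) X = R U (R V X) := by
  simp only [R, Units.val_mul, mul_inv_rev, mul_assoc]

/-- `R(U⁻¹)R(U)X = X`. [folklore] -/
@[simp] theorem R_inv_R (U : 𝔸ˣ) (X : 𝔸) : R U⁻¹ (R U X) = X := by
  rw [← R_mul, inv_mul_cancel, R_one]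

/-- `R(U)R(U⁻¹)X = X`. [folklore] -/
@[simp] theorem R_R_inv (U : 𝔸ˣ) (X : 𝔸) : R U (R U⁻¹ X) = X := by
  rw [← R_mul, mul_inv_cancel, R_one]

/-- `R(U)` is multiplicative: `R(U)X · R(U)Y = R(U)(XY)`. [folklore] -/
theorem R_mul_R (U : 𝔸ˣ) (X Y : 𝔸) : R U X * R U Y = R U (X * Y) := by
  simp only [R, mul_assoc, Units.inv_mul_cancel_left]

/-- `R(U)` commutes with scalars. [folklore] -/
theorem R_smul {𝕂 : Type*} [CommSemiring 𝕂] [Algebra 𝕂 𝔸] (U : 𝔸ˣ) (c : 𝕂) (X : 𝔸) :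
    R U (c • X) = c • R U X := by
  simp only [R, mul_smul_comm, smul_mul_assoc]

variable {𝕜 : Type*} {Φ : Type*} [FunLike Φ 𝔸 𝕜]

/-- TRACE CYCLICITY MOVES THE TRANSPORT ACROSS A PRODUCT: for an additive `τ` with `τ(ab) = τ(ba)`,
`τ(R(U)X · Y) = τ(X · R(U⁻¹)Y)` — the one algebraic fact behind the adjointness formulas (3.8)/(3.9). [folklore] -/
theorem trace_R_mul (τ : Φ) (hτ : ∀ a b : 𝔸, τ (a * b) = τ (b * a)) (U : 𝔸ˣ) (X Y : 𝔸) :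
    τ (R U X * Y) = τ (X * R U⁻¹ Y) := by
  simp only [R, inv_inv, mul_assoc]
  rw [hτ]
  simp only [mul_assoc]

/-- `τ(R(U)X) = τ(X)`. [folklore] -/
theorem trace_R (τ : Φ) (hτ : ∀ a b : 𝔸, τ (a * b) = τ (b * a)) (U : 𝔸ˣ) (X : 𝔸) : τ (R U X) = τ X := by
  simpa using trace_R_mul τ hτ U X 1

end Transport

/-! ## §2  The lattice operators of pp. 390–392 at `η = 1`: `D_μ` (3.3), the curl `D_U` (3.4), `D*_μ`, `D*` (3.8), (3.9) -/

section Lattice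

variable {𝔸 : Type*} [Ring 𝔸] {S : Type*} {ι : Type*}
variable (T : ι → Equiv.Perm S) (U : ι → S → 𝔸ˣ)

/-- (3.3) at `η = 1`: the covariant derivative of a site function along the positive bond `⟨x, x + e_μ⟩`,
`(D_{U,μ}f)(x) = R(U(x, x+e_μ))f(x+e_μ) − f(x)`; `T μ` is the shift `x ↦ x + e_μ` (a bijection of the finite site set),
`U μ x = U(x, x+e_μ)`. [folklore] [cite: Balaban1985BackgroundPropagators, (3.3) p.390] -/
def covD (μ : ι) (f : S → 𝔸) (x : S) : 𝔸 := R (U μ x) (f (T μ x)) - f x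

/-- (3.8)'s `D*_μ` at `η = 1`: `(D*_μ G)(x) = R(U(x, x−e_μ))G(x−e_μ) − G(x)` with `U(x, x−e_μ) = U(x−e_μ, x)⁻¹` by (3.5) —
the covariant derivative along the REVERSED bond. [folklore] [cite: Balaban1985BackgroundPropagators, (3.8) p.392, (3.5) p.391] -/
def covDstar (μ : ι) (G : S → 𝔸) (x : S) : 𝔸 := R (U μ ((T μ).symm x))⁻¹ (G ((T μ).symm x)) - G x

/-- (3.4) at `η = 1`: the covariant curl of a bond function at the plaquette `p_{μν}(x)`,
`(D_U A)(p_{μν}(x)) = (D_{U,μ}A_ν)(x) − (D_{U,ν}A_μ)(x)`. [folklore] [cite: Balaban1985BackgroundPropagators, (3.4) p.391] -/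
def curl (A : ι → S → 𝔸) (μ ν : ι) (x : S) : 𝔸 := covD T U μ (A ν) x - covD T U ν (A μ) x

/-- The plaquette variable `U(∂p)` of `p = p_{μν}(x)`, `∂p = ⟨x,y⟩⟨y,z⟩⟨z,w⟩⟨w,x⟩`, `y = x+e_μ`, `w = x+e_ν`:
`U(∂p) = U(x,y)U(y,z)U(w,z)⁻¹U(x,w)⁻¹` with `U(y,z) = U_ν(y)`, `U(w,z) = U_μ(w)` (on `T_η` the shifts commute and `z = y+e_ν = w+e_μ`;
none of the algebra below uses this). [folklore] [cite: Balaban1985BackgroundPropagators, (3.1) p.390] -/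
def plaqU (μ ν : ι) (x : S) : 𝔸ˣ := U μ x * U ν (T μ x) * (U μ (T ν x))⁻¹ * (U ν x)⁻¹

/-- The four letters `A′(b)`, `b ⊂ ∂(p)_z`, of (3.2) in the order of the contour `⟨z,w⟩⟨w,x⟩⟨x,y⟩⟨y,z⟩` starting at `z = x+e_μ+e_ν`,
transported to the base point `x` and with (3.5) on the reversed bonds:
`A′(z,w) = −R(U(x,w))A_μ(w)`, `A′(w,x) = −A_ν(x)`, `A′(x,y) = A_μ(x)`, `A′(y,z) = R(U(x,y))A_ν(y)`. [folklore]
[cite: Balaban1985BackgroundPropagators, (3.2) p.390, (3.5) p.391] -/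
def lettersA (A : ι → S → 𝔸) (μ ν : ι) (x : S) : List 𝔸 :=
  [-(R (U ν x) (A μ (T ν x))), -(A ν x), A μ x, R (U μ x) (A ν (T μ x))]

/-- `Σ_{b⊂∂(p)_z} A′(b) = (D¹_U A)(p)`: the letter sum IS the unit-lattice curl ((3.4) read with (3.2)/(3.5)). [folklore]
[cite: Balaban1985BackgroundPropagators, (3.4) p.391] -/
theorem sum_lettersA (A : ι → S → 𝔸) (μ ν : ι) (x : S) : (lettersA T U A μ ν x).sum = curl T U A μ ν x := by
  simp only [lettersA, List.sum_cons, List.sum_nil, curl, covD]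
  abel

/-- `D_μ` is additive. [folklore] -/
theorem covD_add (μ : ι) (f g : S → 𝔸) (x : S) : covD T U μ (f + g) x = covD T U μ f x + covD T U μ g x := by
  simp only [covD, Pi.add_apply, R_add]; abel

/-- `D_μ(f − g) = D_μf − D_μg`. [folklore] -/
theorem covD_sub (μ : ι) (f g : S → 𝔸) (x : S) : covD T U μ (f - g) x = covD T U μ f x - covD T U μ g x := by
  simp only [covD, Pi.sub_apply, R_sub]; abel

/-- `D_μ(−f) = −D_μf`. [folklore] -/
theorem covD_neg (μ : ι) (f : S → 𝔸) (x : S) : covD T U μ (-f) x = -covD T U μ f x := by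
  simp only [covD, Pi.neg_apply, R_neg]; abel

/-- `D_μ0 = 0`. [folklore] -/
@[simp] theorem covD_zero (μ : ι) (x : S) : covD T U μ (0 : S → 𝔸) x = 0 := by
  simp [covD]

/-- `D*_μ` is additive. [folklore] -/
theorem covDstar_add (μ : ι) (f g : S → 𝔸) (x : S) :
    covDstar T U μ (f + g) x = covDstar T U μ f x + covDstar T U μ g x := by
  simp only [covDstar, Pi.add_apply, R_add]; abel

/-- `D*_μ(f − g) = D*_μf − D*_μg`. [folklore] -/
theorem covDstar_sub (μ : ι) (f g : S → 𝔸) (x : S) :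
    covDstar T U μ (f - g) x = covDstar T U μ f x - covDstar T U μ g x := by
  simp only [covDstar, Pi.sub_apply, R_sub]; abel

/-- `D*_μ(−f) = −D*_μf`. [folklore] -/
theorem covDstar_neg (μ : ι) (f : S → 𝔸) (x : S) : covDstar T U μ (-f) x = -covDstar T U μ f x := by
  simp only [covDstar, Pi.neg_apply, R_neg]; abel

/-- `D*_μ0 = 0`. [folklore] -/
@[simp] theorem covDstar_zero (μ : ι) (x : S) : covDstar T U μ (0 : S → 𝔸) x = 0 := by
  simp [covDstar]

/-- The curl is ANTISYMMETRIC in the two directions («F_{μν}(x) = −F_{νμ}(x)» holds for `F = D_U A`). [folklore] -/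
theorem curl_swap (A : ι → S → 𝔸) (μ ν : ι) (x : S) : curl T U A ν μ x = -curl T U A μ ν x := by
  simp only [curl]; abel

/-- … and vanishes on the diagonal. [folklore] -/
@[simp] theorem curl_self (A : ι → S → 𝔸) (μ : ι) (x : S) : curl T U A μ μ x = 0 := by
  simp [curl]

variable [Fintype ι]

/-- (3.8) at `η = 1`: the site divergence `(D*A)(x) = Σ_μ (D*_μ A_μ)(x)`. [folklore]
[cite: Balaban1985BackgroundPropagators, (3.8) p.392] -/
def divB (A : ι → S → 𝔸) (x : S) : 𝔸 := ∑ μ, covDstar T U μ (A μ) x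

variable [LinearOrder ι]

/-- (3.9) at `η = 1`, FIRST FORM: the adjoint of the curl, acting on plaquette functions `F_{μν}(x) = F(p_{μν}(x))`,
`(D*F)_μ(x) = Σ_{ν<μ}(D*_ν F_{νμ})(x) − Σ_{ν>μ}(D*_ν F_{μν})(x)`. [folklore] [cite: Balaban1985BackgroundPropagators, (3.9) p.392] -/
def divP (F : ι → ι → S → 𝔸) (μ : ι) (x : S) : 𝔸 :=
  (∑ ν, if ν < μ then covDstar T U ν (F ν μ) x else 0) - ∑ ν, if μ < ν then covDstar T U ν (F μ ν) x else 0

/-- (3.9), LAST FORM: «= Σ_{ν=1}^d (D*_ν F_{νμ})(x) … we have assumed that F_{μν}(x) = −F_{νμ}(x)» — for an antisymmetric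
plaquette function vanishing on the diagonal. [folklore] [cite: Balaban1985BackgroundPropagators, (3.9) p.392] -/
theorem divP_eq_sum_of_antisymm (F : ι → ι → S → 𝔸) (hF : ∀ μ ν x, F ν μ x = -F μ ν x)
    (hF0 : ∀ μ x, F μ μ x = 0) (μ : ι) (x : S) :
    divP T U F μ x = ∑ ν, covDstar T U ν (F ν μ) x := by
  rw [divP, ← Finset.sum_sub_distrib]
  refine Finset.sum_congr rfl fun ν _ => ?_
  rcases lt_trichotomy ν μ with h | rfl | h
  · simp [h, lt_asymm h]
  · have h0 : F ν ν = 0 := funext (hF0 ν)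
    simp [h0]
  · have h1 : F ν μ = -F μ ν := funext fun y => by rw [Pi.neg_apply]; exact hF μ ν y
    simp [h, lt_asymm h, h1, covDstar_neg]

/-- (3.9), last form, for the curl itself: `(D*D_U A)_μ(x) = Σ_ν (D*_ν (D_U A)_{νμ})(x)`. [folklore] -/
theorem divP_curl (A : ι → S → 𝔸) (μ : ι) (x : S) :
    divP T U (curl T U A) μ x = ∑ ν, covDstar T U ν (curl T U A ν μ) x :=
  divP_eq_sum_of_antisymm T U _ (fun μ ν x => curl_swap T U A μ ν x) (fun μ x => curl_self T U A μ x) μ x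

end Lattice

/-! ## §3  The adjointness identities (3.8), (3.9): summation by parts over a finite lattice with bijective shifts -/

section Adjoint

variable {𝔸 : Type*} [Ring 𝔸] {S : Type*} [Fintype S] {ι : Type*}
variable (T : ι → Equiv.Perm S) (U : ι → S → 𝔸ˣ)
variable {𝕜 : Type*} [AddCommGroup 𝕜] {Φ : Type*} [FunLike Φ 𝔸 𝕜] [AddMonoidHomClass Φ 𝔸 𝕜]

/-- SUMMATION BY PARTS ALONG ONE DIRECTION (the third form of (3.8), `(D*_μ A_μ)(x) = (DA_μ)(x, x−e_μ)`):
`Σ_x τ((D_μ f)(x)·G(x)) = Σ_x τ(f(x)·(D*_μ G)(x))` — reindex `x ↦ x − e_μ` over the bijection `T μ` and move the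
transport with `trace_R_mul`; NO commutation of shifts, NO unitarity. [folklore] [cite: Balaban1985BackgroundPropagators, (3.8) p.392] -/
theorem sum_covD_mul (τ : Φ) (hτ : ∀ a b : 𝔸, τ (a * b) = τ (b * a)) (μ : ι) (f G : S → 𝔸) :
    ∑ x, τ (covD T U μ f x * G x) = ∑ x, τ (f x * covDstar T U μ G x) := by
  have h1 : ∀ x, τ (covD T U μ f x * G x) = τ (f (T μ x) * R (U μ x)⁻¹ (G x)) - τ (f x * G x) := by
    intro x; rw [covD, sub_mul, map_sub, trace_R_mul τ hτ]
  have h2 : ∑ x, τ (f (T μ x) * R (U μ x)⁻¹ (G x))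
      = ∑ y, τ (f y * R (U μ ((T μ).symm y))⁻¹ (G ((T μ).symm y))) := by
    rw [← Equiv.sum_comp (T μ) (fun y => τ (f y * R (U μ ((T μ).symm y))⁻¹ (G ((T μ).symm y))))]
    simp only [Equiv.symm_apply_apply]
  simp only [h1, Finset.sum_sub_distrib, h2, covDstar, mul_sub, map_sub]

variable [Fintype ι]

/-- **(3.8) ADJOINTNESS**: `Σ_x Σ_μ τ((D_{U,μ}f)(x)·A_μ(x)) = Σ_x τ(f(x)·(D*A)(x))` — the site divergence `D*` of (3.8) is the
adjoint of the covariant gradient for the trace pairing, exact background. [folklore] [cite: Balaban1985BackgroundPropagators, (3.8) p.392] -/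
theorem sum_sum_covD_mul (τ : Φ) (hτ : ∀ a b : 𝔸, τ (a * b) = τ (b * a)) (f : S → 𝔸) (A : ι → S → 𝔸) :
    ∑ x, ∑ μ, τ (covD T U μ f x * A μ x) = ∑ x, τ (f x * divB T U A x) := by
  rw [Finset.sum_comm]
  simp only [sum_covD_mul T U τ hτ, divB, Finset.mul_sum, map_sum]
  rw [Finset.sum_comm]

variable [LinearOrder ι]

omit [Fintype S] in
/-- `[p]a − [p]b = [p](a − b)`. [folklore] -/
private theorem ite_sub_ite (p : Prop) [Decidable p] (a b : 𝕜) :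
    (if p then a else 0) - (if p then b else 0) = if p then a - b else 0 := by
  split_ifs <;> simp

/-- **(3.9) ADJOINTNESS** («The operator adjoint to derivative D, acting on functions defined at bonds, is the operator acting on
functions F defined at plaquetts by the formula … (3.9)»): summing over the POSITIVELY ORIENTED plaquettes `p_{μν}(x)`, `μ < ν`,
`Σ_x Σ_{μ<ν} τ((D_U A)(p_{μν}(x))·F_{μν}(x)) = Σ_x Σ_μ τ(A_μ(x)·(D*F)_μ(x))` with the FIRST form of `D*F` — exact background,
any ring, any additive tracial `τ`, any finite site set with bijective shifts. [folklore] [cite: Balaban1985BackgroundPropagators, (3.9) p.392] -/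
theorem sum_curl_mul (τ : Φ) (hτ : ∀ a b : 𝔸, τ (a * b) = τ (b * a)) (A : ι → S → 𝔸) (F : ι → ι → S → 𝔸) :
    ∑ x, ∑ μ, ∑ ν, (if μ < ν then τ (curl T U A μ ν x * F μ ν x) else 0)
      = ∑ x, ∑ μ, τ (A μ x * divP T U F μ x) := by
  -- the two summation-by-parts integrals of a pair of directions
  set P : ι → ι → 𝕜 := fun μ ν => ∑ x, τ (A ν x * covDstar T U μ (F μ ν) x) with hP
  set Q : ι → ι → 𝕜 := fun μ ν => ∑ x, τ (A μ x * covDstar T U ν (F μ ν) x) with hQ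
  -- left side: push the site sum inside and integrate by parts
  have hL : ∑ x, ∑ μ, ∑ ν, (if μ < ν then τ (curl T U A μ ν x * F μ ν x) else 0)
      = ∑ μ, ∑ ν, if μ < ν then P μ ν - Q μ ν else 0 := by
    rw [Finset.sum_comm]
    refine Finset.sum_congr rfl fun μ _ => ?_
    rw [Finset.sum_comm]
    refine Finset.sum_congr rfl fun ν _ => ?_
    split_ifs with h
    · simp only [hP, hQ, curl, sub_mul, map_sub, Finset.sum_sub_distrib, sum_covD_mul T U τ hτ]
    · simp
  -- right side: expand the first form of `D*F`
  have hR : ∑ x, ∑ μ, τ (A μ x * divP T U F μ x)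
      = (∑ μ, ∑ ν, if ν < μ then P ν μ else 0) - ∑ μ, ∑ ν, if μ < ν then Q μ ν else 0 := by
    have e : ∀ x μ, τ (A μ x * divP T U F μ x)
        = (∑ ν, if ν < μ then τ (A μ x * covDstar T U ν (F ν μ) x) else 0)
          - ∑ ν, if μ < ν then τ (A μ x * covDstar T U ν (F μ ν) x) else 0 := by
      intro x μ
      simp only [divP, mul_sub, map_sub, Finset.mul_sum, map_sum, mul_ite, mul_zero]
      congr 1 <;> exact Finset.sum_congr rfl fun ν _ => by split_ifs <;> simp
    simp only [e, Finset.sum_sub_distrib]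
    congr 1
    · rw [Finset.sum_comm]
      refine Finset.sum_congr rfl fun μ _ => ?_
      rw [Finset.sum_comm]
      refine Finset.sum_congr rfl fun ν _ => ?_
      split_ifs with h
      · simp only [hP]
      · simp
    · rw [Finset.sum_comm]
      refine Finset.sum_congr rfl fun μ _ => ?_
      rw [Finset.sum_comm]
      refine Finset.sum_congr rfl fun ν _ => ?_
      split_ifs with h
      · simp only [hQ]
      · simp
  rw [hL, hR, Finset.sum_comm (f := fun μ ν => if ν < μ then P ν μ else 0), ← Finset.sum_sub_distrib]
  refine Finset.sum_congr rfl fun μ _ => ?_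
  rw [← Finset.sum_sub_distrib]
  exact Finset.sum_congr rfl fun ν _ => (ite_sub_ite _ _ _).symm

/-- (3.9) WITH THE LAST FORM OF `D*F` for an antisymmetric `F` vanishing on the diagonal:
`Σ_x Σ_{μ<ν} τ((D_U A)(p_{μν}(x))·F_{μν}(x)) = Σ_x Σ_μ τ(A_μ(x)·Σ_ν (D*_ν F_{νμ})(x))`. [folklore]
[cite: Balaban1985BackgroundPropagators, (3.9) p.392] -/
theorem sum_curl_mul_antisymm (τ : Φ) (hτ : ∀ a b : 𝔸, τ (a * b) = τ (b * a)) (A : ι → S → 𝔸)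
    (F : ι → ι → S → 𝔸) (hF : ∀ μ ν x, F ν μ x = -F μ ν x) (hF0 : ∀ μ x, F μ μ x = 0) :
    ∑ x, ∑ μ, ∑ ν, (if μ < ν then τ (curl T U A μ ν x * F μ ν x) else 0)
      = ∑ x, ∑ μ, τ (A μ x * ∑ ν, covDstar T U ν (F ν μ) x) := by
  rw [sum_curl_mul T U τ hτ]
  simp only [divP_eq_sum_of_antisymm T U F hF hF0]

/-- **THE `D*D` FORM OF (3.10)**: `⟨A, D*D_U A⟩ = Σ_p τ(((D_U A)(p))²)` over positively oriented plaquettes — (3.9) with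
`F = D_U A`. [folklore] [cite: Balaban1985BackgroundPropagators, (3.10) p.392] -/
theorem sum_mul_divP_curl (τ : Φ) (hτ : ∀ a b : 𝔸, τ (a * b) = τ (b * a)) (A : ι → S → 𝔸) :
    ∑ x, ∑ μ, τ (A μ x * divP T U (curl T U A) μ x)
      = ∑ x, ∑ μ, ∑ ν, (if μ < ν then τ (curl T U A μ ν x * curl T U A μ ν x) else 0) :=
  (sum_curl_mul T U τ hτ A (curl T U A)).symm

end Adjoint

/-! ## §4  Positively oriented plaquettes as a finite set; (3.9) as «Σ_{p ⊂ T}» -/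

section PosPlaq

variable (S : Type*) [Fintype S] (ι : Type*) [Fintype ι] [LinearOrder ι]

/-- The positively oriented plaquettes `p_{μν}(x)`, `μ < ν`, as triples `(x, μ, ν)` («Σ_{p⊂T_η}» in (3.1), (3.7), (3.10)).
[folklore] -/
def posPlaq : Finset (S × ι × ι) := Finset.univ.filter fun q => q.2.1 < q.2.2

variable {S ι}

/-- Membership in `posPlaq`: `μ < ν`. [folklore] -/
@[simp] theorem mem_posPlaq (q : S × ι × ι) : q ∈ posPlaq S ι ↔ q.2.1 < q.2.2 := by
  simp [posPlaq]

/-- `Σ_{p⊂T}` is the iterated sum `Σ_x Σ_μ Σ_ν [μ < ν]`. [folklore] -/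
theorem sum_posPlaq {M : Type*} [AddCommMonoid M] (g : S → ι → ι → M) :
    ∑ q ∈ posPlaq S ι, g q.1 q.2.1 q.2.2 = ∑ x, ∑ μ, ∑ ν, if μ < ν then g x μ ν else 0 := by
  rw [posPlaq, Finset.sum_filter, Fintype.sum_prod_type]
  exact Finset.sum_congr rfl fun x _ => Fintype.sum_prod_type _

variable {𝔸 : Type*} [Ring 𝔸] (T : ι → Equiv.Perm S) (U : ι → S → 𝔸ˣ)
variable {𝕜 : Type*} [AddCommGroup 𝕜] {Φ : Type*} [FunLike Φ 𝔸 𝕜] [AddMonoidHomClass Φ 𝔸 𝕜]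

/-- **(3.9) over the set of positively oriented plaquettes**: `Σ_{p⊂T} τ((D_U A)(p)·F(p)) = Σ_{b⊂T} τ(A(b)·(D*F)(b))`.
[folklore] [cite: Balaban1985BackgroundPropagators, (3.9) p.392] -/
theorem sum_posPlaq_curl_mul (τ : Φ) (hτ : ∀ a b : 𝔸, τ (a * b) = τ (b * a)) (A : ι → S → 𝔸)
    (F : ι → ι → S → 𝔸) :
    ∑ q ∈ posPlaq S ι, τ (curl T U A q.2.1 q.2.2 q.1 * F q.2.1 q.2.2 q.1)
      = ∑ x, ∑ μ, τ (A μ x * divP T U F μ x) := by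
  rw [sum_posPlaq (fun x μ ν => τ (curl T U A μ ν x * F μ ν x))]
  exact sum_curl_mul T U τ hτ A F

end PosPlaq

/-! ## §5  The powers of `η` as printed: `D^η = η⁻¹D¹` (3.3)/(3.4), `D^{η*} = η⁻¹D^{1*}` (3.8)/(3.9), `⟨A,E⟩ = Σ_b η^d tr A(b)E(b)` (3.11) -/

section Scaled

variable {𝔸 : Type*} [Ring 𝔸] [Algebra ℂ 𝔸] {S : Type*} {ι : Type*}
variable (T : ι → Equiv.Perm S) (U : ι → S → 𝔸ˣ)

/-- `D_μ` commutes with scalars. [folklore] -/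
theorem covD_smul (c : ℂ) (μ : ι) (f : S → 𝔸) (x : S) : covD T U μ (c • f) x = c • covD T U μ f x := by
  simp only [covD, Pi.smul_apply, R_smul, smul_sub]

/-- `D*_μ` commutes with scalars. [folklore] -/
theorem covDstar_smul (c : ℂ) (μ : ι) (f : S → 𝔸) (x : S) :
    covDstar T U μ (c • f) x = c • covDstar T U μ f x := by
  simp only [covDstar, Pi.smul_apply, R_smul, smul_sub]

/-- The curl commutes with scalars. [folklore] -/
theorem curl_smul (c : ℂ) (A : ι → S → 𝔸) (μ ν : ι) (x : S) :
    curl T U (c • A) μ ν x = c • curl T U A μ ν x := by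
  simp only [curl, Pi.smul_def, covD, R_smul, smul_sub]

/-- (3.4) with its `η⁻¹`: `(D^η_U A)(p_{μν}(x)) = η⁻¹·(D¹_U A)(p_{μν}(x))`. [folklore]
[cite: Balaban1985BackgroundPropagators, (3.4) p.391] -/
def curlη (η : ℝ) (A : ι → S → 𝔸) (μ ν : ι) (x : S) : 𝔸 := ((η : ℂ)⁻¹) • curl T U A μ ν x

variable [Fintype ι] [LinearOrder ι]

/-- The plaquette adjoint `D*` commutes with scalars. [folklore] -/
theorem divP_smul (c : ℂ) (F : ι → ι → S → 𝔸) (μ : ι) (x : S) :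
    divP T U (c • F) μ x = c • divP T U F μ x := by
  simp only [divP, Pi.smul_def, covDstar, R_smul, smul_sub, Finset.smul_sum, smul_ite, smul_zero]

omit [Fintype ι] [LinearOrder ι] in
/-- Over `ℂ` an element equal to its negative vanishes (no `2`-torsion): the diagonal of an antisymmetric plaquette function
is zero. [folklore] -/
theorem eq_zero_of_eq_neg_self {X : 𝔸} (h : X = -X) : X = 0 := by
  have h2 : (2 : ℂ) • X = 0 := by
    rw [two_smul]
    nth_rewrite 2 [h]
    exact add_neg_cancel X
  rw [← inv_smul_smul₀ (two_ne_zero (α := ℂ)) X, h2, smul_zero]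

/-- (3.9), LAST FORM, over `ℂ`: antisymmetry `F_{μν}(x) = −F_{νμ}(x)` ALONE gives `(D*F)_μ(x) = Σ_ν (D*_ν F_{νμ})(x)` — exactly
the printed hypothesis. [folklore] [cite: Balaban1985BackgroundPropagators, (3.9) p.392] -/
theorem divP_eq_sum_of_antisymm' (F : ι → ι → S → 𝔸) (hF : ∀ μ ν x, F ν μ x = -F μ ν x) (μ : ι) (x : S) :
    divP T U F μ x = ∑ ν, covDstar T U ν (F ν μ) x :=
  divP_eq_sum_of_antisymm T U F hF (fun μ x => eq_zero_of_eq_neg_self (hF μ μ x)) μ x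

/-- (3.9) with the `η⁻¹` of (3.8): `(D^{η*}F)_μ(x) = η⁻¹·(D^{1*}F)_μ(x)`. [folklore]
[cite: Balaban1985BackgroundPropagators, (3.8) p.392, (3.9) p.392] -/
def divPη (η : ℝ) (F : ι → ι → S → 𝔸) (μ : ι) (x : S) : 𝔸 := ((η : ℂ)⁻¹) • divP T U F μ x

variable [Fintype S]

/-- (3.11): the bond pairing `⟨A, E⟩ = Σ_{b⊂T_η} η^d tr A(b)E(b)` for a ℂ-linear `τ` in the rôle of `tr`. [folklore]
[cite: Balaban1985BackgroundPropagators, (3.11) p.392] -/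
def bondPair (η : ℝ) (d : ℕ) (τ : 𝔸 →ₗ[ℂ] ℂ) (A E : ι → S → 𝔸) : ℂ := (η : ℂ) ^ d * ∑ x, ∑ μ, τ (A μ x * E μ x)

/-- (3.11): the current `J = D^{η*}(η⁻² Im ∂U)`, `(∂U)(p) = U(∂p)`, with the complexified `Im` of p. 391
(`B9Eq37Insertion.imC`). [folklore] [cite: Balaban1985BackgroundPropagators, (3.11) p.392, p.391] -/
def J (η : ℝ) : ι → S → 𝔸 := divPη T U η fun μ ν x => (((η : ℂ)⁻¹) ^ 2) • imC (plaqU T U μ ν x)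

/-- **(3.9) WITH THE PRINTED WEIGHTS**: `⟨A, D^{η*}F⟩ = Σ_{p⊂T_η} η^d τ((D^η_U A)(p)·F(p))` — the `η⁻¹` of `D^η` and of `D^{η*}`
match, the `η^d` is common. [folklore] [cite: Balaban1985BackgroundPropagators, (3.9) p.392, (3.11) p.392] -/
theorem bondPair_divPη (τ : 𝔸 →ₗ[ℂ] ℂ) (hτ : ∀ a b : 𝔸, τ (a * b) = τ (b * a)) (η : ℝ) (d : ℕ) (A : ι → S → 𝔸)
    (F : ι → ι → S → 𝔸) :
    bondPair η d τ A (divPη T U η F)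
      = (η : ℂ) ^ d * ∑ q ∈ posPlaq S ι, τ (curlη T U η A q.2.1 q.2.2 q.1 * F q.2.1 q.2.2 q.1) := by
  simp only [bondPair, divPη, curlη, smul_mul_assoc, mul_smul_comm, map_smul, smul_eq_mul, ← Finset.mul_sum]
  rw [sum_posPlaq_curl_mul T U τ hτ A F]

/-- In particular `⟨A, J⟩ = Σ_{p⊂T_η} η^d τ((D^η_U A)(p)·η⁻² Im U(∂p))` — the FIRST-ORDER TERM of (3.7) is `⟨A,J⟩` of (3.11).
[folklore] [cite: Balaban1985BackgroundPropagators, (3.7) p.391, (3.11) p.392] -/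
theorem bondPair_J (τ : 𝔸 →ₗ[ℂ] ℂ) (hτ : ∀ a b : 𝔸, τ (a * b) = τ (b * a)) (η : ℝ) (d : ℕ) (A : ι → S → 𝔸) :
    bondPair η d τ A (J T U η)
      = (η : ℂ) ^ d * ∑ q ∈ posPlaq S ι,
          τ (curlη T U η A q.2.1 q.2.2 q.1 * ((((η : ℂ)⁻¹) ^ 2) • imC (plaqU T U q.2.1 q.2.2 q.1))) :=
  bondPair_divPη T U τ hτ η d A _

/-- … and `⟨A, D^{η*}D^η_U A⟩ = Σ_{p⊂T_η} η^d τ(((D^η_U A)(p))²)` — the `D*D` PART of (3.10). [folklore]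
[cite: Balaban1985BackgroundPropagators, (3.10) p.392] -/
theorem bondPair_divPη_curlη (τ : 𝔸 →ₗ[ℂ] ℂ) (hτ : ∀ a b : 𝔸, τ (a * b) = τ (b * a)) (η : ℝ) (d : ℕ)
    (A : ι → S → 𝔸) :
    bondPair η d τ A (divPη T U η (curlη T U η A))
      = (η : ℂ) ^ d * ∑ q ∈ posPlaq S ι, τ (curlη T U η A q.2.1 q.2.2 q.1 * curlη T U η A q.2.1 q.2.2 q.1) :=
  bondPair_divPη T U τ hτ η d A _

end Scaled

/-! ## §6  The assembly (3.7) → (3.10), (3.11), (3.12) on a finite lattice, EXACT background -/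

section Assembly

variable {𝔸 : Type*} [NormedRing 𝔸] [NormedAlgebra ℂ 𝔸] [CompleteSpace 𝔸]
variable {S : Type*} [Fintype S] {ι : Type*} [Fintype ι] [LinearOrder ι]
variable (T : ι → Equiv.Perm S) (U : ι → S → 𝔸ˣ)

omit [CompleteSpace 𝔸] [Fintype S] [Fintype ι] [LinearOrder ι] in
/-- Print's `X = (D^η_{U₀}A)(p)` of the lineage leaf (`B9Eq37Insertion.plaqD η [A′(b)]`) IS `η⁻¹·(D¹_U A)(p)` on the lattice.
[folklore] [cite: Balaban1985BackgroundPropagators, (3.4) p.391] -/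
theorem plaqD_lettersA (η : ℝ) (A : ι → S → 𝔸) (μ ν : ι) (x : S) :
    plaqD η (lettersA T U A μ ν x) = curlη T U η A μ ν x := by
  unfold plaqD curlη
  rw [sum_lettersA]

/-- (3.10): `⟨A, Δ′A⟩ = Σ_{p⊂T_η} η^d [tr((D¹_U A)(p))² η⁻²(Re U(∂p) − 1) + tr Σ_{b₁,b₂⊂∂(p)_z, b₁≺b₂} i[A′(b₁),A′(b₂)] η⁻² Im U(∂p)]`
letter for letter, with the complexified `Re`, `Im` of p. 391 and `Σ_{b₁≺b₂}[A′(b₁),A′(b₂)] = commSum [A′(b)]`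
(`Beta.TransportVertices.commSum`). [folklore] [cite: Balaban1985BackgroundPropagators, (3.10) p.392] -/
def deltaPrime (η : ℝ) (d : ℕ) (τ : 𝔸 →ₗ[ℂ] ℂ) (A : ι → S → 𝔸) : ℂ :=
  (η : ℂ) ^ d * ∑ q ∈ posPlaq S ι,
    (τ (curl T U A q.2.1 q.2.2 q.1 * curl T U A q.2.1 q.2.2 q.1 * ((((η : ℂ)⁻¹) ^ 2) • (reC (plaqU T U q.2.1 q.2.2 q.1) - 1)))
      + τ ((I • commSum (lettersA T U A q.2.1 q.2.2 q.1)) * ((((η : ℂ)⁻¹) ^ 2) • imC (plaqU T U q.2.1 q.2.2 q.1))))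

/-- (3.10): `⟨A, ΔA⟩ = ⟨A, D*D_U A⟩ + ⟨A, Δ′A⟩`. [folklore] [cite: Balaban1985BackgroundPropagators, (3.10) p.392] -/
def hessPair (η : ℝ) (d : ℕ) (τ : 𝔸 →ₗ[ℂ] ℂ) (A : ι → S → 𝔸) : ℂ :=
  bondPair η d τ A (divPη T U η (curlη T U η A)) + deltaPrime T U η d τ A

/-- The third-order remainder of one plaquette (`B9Eq37Insertion.rem` along `∂p` and along `−∂p`), with the `η^{d−4}` of (3.1)
NOT included. [folklore] -/
def rem3 (η : ℝ) (τ : 𝔸 →ₗ[ℂ] ℂ) (A : ι → S → 𝔸) (μ ν : ι) (x : S) : ℂ :=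
  -(2 : ℂ)⁻¹ * (τ (rem (letters η (lettersA T U A μ ν x)) * (plaqU T U μ ν x : 𝔸))
    + τ ((((plaqU T U μ ν x)⁻¹ : 𝔸ˣ) : 𝔸) * rem (invPath (letters η (lettersA T U A μ ν x)))))

/-- (3.1) in the complexified reading of p. 391: `A^η(V) = Σ_{p⊂T_η} η^{d−4}(τ1 − τ Re V(∂p))` (`B9Eq37Insertion.wil`).
[folklore] [cite: Balaban1985BackgroundPropagators, (3.1) p.390, p.391] -/
def action (η : ℝ) (d : ℕ) (τ : 𝔸 →ₗ[ℂ] ℂ) (V : ι → S → 𝔸ˣ) : ℂ :=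
  ∑ q ∈ posPlaq S ι, (η : ℂ) ^ (d - 4) * wil τ (plaqU T V q.2.1 q.2.2 q.1)

omit [CompleteSpace 𝔸] [Fintype S] [Fintype ι] [LinearOrder ι] in
/-- `(aX)(aX)Y = X·X·(a²Y)`. [folklore] -/
private theorem smul_sq_mul (a : ℂ) (X Y : 𝔸) : (a • X) * (a • X) * Y = X * X * ((a ^ 2) • Y) := by
  simp only [smul_mul_assoc, mul_smul_comm, smul_smul, pow_two]

omit [Fintype S] [Fintype ι] [LinearOrder ι] in
/-- THE (3.7) SUMMAND OF ONE PLAQUETTE, REARRANGED INTO THE (3.10)/(3.11) TERMS: with `X = (D^η_U A)(p)`, `W = U(∂p)`,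
`η^{d−4}(wil τ (P·W) − wil τ W) = η^d τ(X·η⁻²Im W) + ½[η^d τ(X²) + η^d(τ((D¹A)²·η⁻²(Re W − 1)) + τ(iC·η⁻²Im W))] + η^{d−4}ρ`.
[folklore] [cite: Balaban1985BackgroundPropagators, (3.7) p.391, (3.10) p.392] -/
theorem summand_split (τ : 𝔸 →ₗ[ℂ] ℂ) (hτ : ∀ a b : 𝔸, τ (a * b) = τ (b * a)) (η : ℝ) (hη : η ≠ 0) {d : ℕ}
    (hd : 4 ≤ d) (A : ι → S → 𝔸) (μ ν : ι) (x : S) :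
    (η : ℂ) ^ (d - 4) * (wil τ (holU (letters η (lettersA T U A μ ν x)) * plaqU T U μ ν x) - wil τ (plaqU T U μ ν x))
      = (η : ℂ) ^ d * τ (curlη T U η A μ ν x * ((((η : ℂ)⁻¹) ^ 2) • imC (plaqU T U μ ν x)))
        + 2⁻¹ * ((η : ℂ) ^ d * τ (curlη T U η A μ ν x * curlη T U η A μ ν x)
          + (η : ℂ) ^ d * (τ (curl T U A μ ν x * curl T U A μ ν x
              * ((((η : ℂ)⁻¹) ^ 2) • (reC (plaqU T U μ ν x) - 1)))
            + τ ((I • commSum (lettersA T U A μ ν x)) * ((((η : ℂ)⁻¹) ^ 2) • imC (plaqU T U μ ν x)))))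
        + (η : ℂ) ^ (d - 4) * rem3 T U η τ A μ ν x := by
  rw [eq37_summand_dim τ hτ η hη hd, plaqD_lettersA, rem3]
  have hsplit : τ (curlη T U η A μ ν x * curlη T U η A μ ν x * reC (plaqU T U μ ν x))
      = τ (curlη T U η A μ ν x * curlη T U η A μ ν x)
        + τ (curl T U A μ ν x * curl T U A μ ν x * ((((η : ℂ)⁻¹) ^ 2) • (reC (plaqU T U μ ν x) - 1))) := by
    rw [← map_add, curlη, ← smul_sq_mul, mul_sub, mul_one]
    congr 1
    abel
  rw [hsplit]
  ring

/-- **(3.12) ON A FINITE LATTICE, EXACT BACKGROUND, LEAF FORM**: summing the (3.7) summand of `B9Eq37Insertion` over the positively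
oriented plaquettes, `Σ_p η^{d−4}(wil τ (P_p·U(∂p)) − wil τ U(∂p)) = ⟨A,J⟩ + ½⟨A,ΔA⟩ + η^{d−4}Σ_p ρ_p` with `J`, `⟨A,ΔA⟩ = ⟨A,D*DA⟩ +
⟨A,Δ′A⟩` EXACTLY as printed in (3.10)/(3.11) (via the adjointness (3.9)) and `ρ_p` third order (`norm_rem3_le`). [folklore]
[cite: Balaban1985BackgroundPropagators, (3.10) p.392, (3.11) p.392, (3.12) p.392] -/
theorem eq312_letters (τ : 𝔸 →ₗ[ℂ] ℂ) (hτ : ∀ a b : 𝔸, τ (a * b) = τ (b * a)) (η : ℝ) (hη : η ≠ 0) {d : ℕ}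
    (hd : 4 ≤ d) (A : ι → S → 𝔸) :
    ∑ q ∈ posPlaq S ι, (η : ℂ) ^ (d - 4) *
        (wil τ (holU (letters η (lettersA T U A q.2.1 q.2.2 q.1)) * plaqU T U q.2.1 q.2.2 q.1)
          - wil τ (plaqU T U q.2.1 q.2.2 q.1))
      = bondPair η d τ A (J T U η) + 2⁻¹ * hessPair T U η d τ A
        + (η : ℂ) ^ (d - 4) * ∑ q ∈ posPlaq S ι, rem3 T U η τ A q.2.1 q.2.2 q.1 := by
  rw [Finset.sum_congr rfl fun q _ => summand_split T U τ hτ η hη hd A q.2.1 q.2.2 q.1]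
  rw [hessPair, bondPair_J T U τ hτ, bondPair_divPη_curlη T U τ hτ, deltaPrime]
  simp only [Finset.sum_add_distrib, ← Finset.mul_sum]

omit [Fintype S] [Fintype ι] [LinearOrder ι] in
/-- THE REMAINDER IS THIRD ORDER (continuous tracial `τ`; `B9Eq37Insertion.norm_rem_le` and `size_letters` BY NAME):
`‖ρ_p‖ ≤ ½‖τ‖(‖U(∂p)‖ + ‖U(∂p)⁻¹‖)·expTail 3 (|η|·Σ_{b⊂∂p}‖A′(b)‖)`. [folklore] -/
theorem norm_rem3_le (τ : 𝔸 →L[ℂ] ℂ) (η : ℝ) (A : ι → S → 𝔸) (μ ν : ι) (x : S) :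
    ‖rem3 T U η (τ : 𝔸 →ₗ[ℂ] ℂ) A μ ν x‖
      ≤ 2⁻¹ * ‖τ‖ * (‖(plaqU T U μ ν x : 𝔸)‖ + ‖(((plaqU T U μ ν x)⁻¹ : 𝔸ˣ) : 𝔸)‖)
          * expTail 3 (|η| * size (lettersA T U A μ ν x)) := by
  rw [rem3, neg_mul, norm_neg, ← size_letters]
  exact norm_rem_le τ _ _

/-! ### The genuine plaquette variable of the product configuration `U′U₀` (3.1) -/

/-- The fluctuation field as bond units, `U′(b) = exp iηA(b)` («U′ = exp iηA», p. 390). [folklore]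
[cite: Balaban1985BackgroundPropagators, p.390] -/
def fluct (η : ℝ) (A : ι → S → 𝔸) : ι → S → 𝔸ˣ := fun μ x => holU [((I * η : ℂ)) • A μ x]

/-- The product configuration `U = U′U₀` on positive bonds («U = U′U₀», p. 390; (3.5) for the reversed ones is built into `plaqU`).
[folklore] [cite: Balaban1985BackgroundPropagators, p.390, (3.5) p.391] -/
def prodCfg (η : ℝ) (A : ι → S → 𝔸) : ι → S → 𝔸ˣ := fun μ x => fluct η A μ x * U μ x

omit [CompleteSpace 𝔸] [Fintype S] [Fintype ι] [LinearOrder ι] in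
/-- A tracial functional does not see the base point: `wil τ (XY) = wil τ (YX)`. [folklore] -/
theorem wil_mul_comm (τ : 𝔸 →ₗ[ℂ] ℂ) (hτ : ∀ a b : 𝔸, τ (a * b) = τ (b * a)) (X Y : 𝔸ˣ) :
    wil τ (X * Y) = wil τ (Y * X) := by
  simp only [wil, reC, Units.val_mul, mul_inv_rev, map_smul, map_add, hτ (X : 𝔸), hτ (((Y⁻¹ : 𝔸ˣ) : 𝔸))]

omit [Fintype S] [Fintype ι] [LinearOrder ι] in
/-- **(3.1) FOR THE PLAQUETTE VARIABLE** («tr U(∂p) = tr(U′U₀)(∂p) = tr[(∂₀U′)((p)_z)U₀(∂p)]»): under a tracial functional the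
plaquette variable of `U′U₀` may be replaced by `(∂₀U′)((p)_z)·U₀(∂p)` = (ordered product of `exp iηA′(b)`, `b ⊂ ∂(p)_z`) `· U₀(∂p)` —
conjugation through `exp` is `B12Membership314.exp_units_conj'` BY NAME. [folklore] [cite: Balaban1985BackgroundPropagators, (3.1) p.390] -/
theorem wil_plaqU_prodCfg (τ : 𝔸 →ₗ[ℂ] ℂ) (hτ : ∀ a b : 𝔸, τ (a * b) = τ (b * a)) (η : ℝ) (A : ι → S → 𝔸)
    (μ ν : ι) (x : S) :
    wil τ (plaqU T (prodCfg U η A) μ ν x) = wil τ (holU (letters η (lettersA T U A μ ν x)) * plaqU T U μ ν x) := by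
  -- letters `b₁ = iηA_μ(x)`, `b₂ = iηA_ν(x+e_μ)`, `b₃ = iηA_μ(x+e_ν)`, `b₄ = iηA_ν(x)`; `X = e^{b₁}e^{R(U(x,y))b₂}·U₀(∂p)`,
  -- `Y = e^{−R(U(x,w))b₃}e^{−b₄}`:  `(U′U₀)(∂p) = X·Y` (conjugation through `exp`) and `(∂₀U′)((p)_z)·U₀(∂p) = Y·X`.
  have h1 : plaqU T (prodCfg U η A) μ ν x
      = (holU [((I * η : ℂ)) • A μ x, R (U μ x) (((I * η : ℂ)) • A ν (T μ x))] * plaqU T U μ ν x)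
        * holU [-(R (U ν x) (((I * η : ℂ)) • A μ (T ν x))), -(((I * η : ℂ)) • A ν x)] := by
    ext
    simp only [plaqU, prodCfg, fluct, Units.val_mul, mul_inv_rev, val_holU, val_inv_holU, invPath_cons, invPath_nil,
      List.nil_append, holonomy_cons, holonomy_nil, mul_one, R,
      B12Membership314.exp_units_conj', B12Membership314.exp_neg_units_conj']
    simp only [mul_assoc, Units.inv_mul_cancel_left]
  have h2 : holU (letters η (lettersA T U A μ ν x)) * plaqU T U μ ν x
      = holU [-(R (U ν x) (((I * η : ℂ)) • A μ (T ν x))), -(((I * η : ℂ)) • A ν x)]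
        * (holU [((I * η : ℂ)) • A μ x, R (U μ x) (((I * η : ℂ)) • A ν (T μ x))] * plaqU T U μ ν x) := by
    ext
    simp only [letters, lettersA, List.map_cons, List.map_nil, smul_neg, ← R_smul, Units.val_mul, val_holU,
      holonomy_cons, holonomy_nil, mul_one, mul_assoc]
  rw [h1, h2, wil_mul_comm τ hτ]

/-- **(3.12), EXACT BACKGROUND, FINITE LATTICE**: `A^η(U′U₀) = A^η(U₀) + ⟨A,J⟩ + ½⟨A,ΔA⟩ + η^{d−4}Σ_p ρ_p`, with `A^η` the
complexified (3.1), `J = D^{η*}η⁻² Im ∂U₀` (3.11), `⟨A,ΔA⟩ = ⟨A,D*D_U A⟩ + ⟨A,Δ′A⟩` (3.10), the background `U₀` arbitrary units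
(no smallness, no unitarity), and `‖ρ_p‖` third order in `η·Σ‖A′(b)‖` (`norm_rem3_le`). [folklore]
[cite: Balaban1985BackgroundPropagators, (3.12) p.392] -/
theorem eq312 (τ : 𝔸 →ₗ[ℂ] ℂ) (hτ : ∀ a b : 𝔸, τ (a * b) = τ (b * a)) (η : ℝ) (hη : η ≠ 0) {d : ℕ} (hd : 4 ≤ d)
    (A : ι → S → 𝔸) :
    action T η d τ (prodCfg U η A)
      = action T η d τ U + bondPair η d τ A (J T U η) + 2⁻¹ * hessPair T U η d τ A
        + (η : ℂ) ^ (d - 4) * ∑ q ∈ posPlaq S ι, rem3 T U η τ A q.2.1 q.2.2 q.1 := by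
  have h := eq312_letters T U τ hτ η hη hd A
  simp only [mul_sub, Finset.sum_sub_distrib, ← wil_plaqU_prodCfg T U τ hτ η A] at h
  rw [action, action, add_assoc, add_assoc, ← add_assoc (bondPair η d τ A (J T U η)), ← h]
  abel

end Assembly

/-! ## §7  Sanity examples -/

section Examples

variable {𝔸 : Type*} [Ring 𝔸] {S : Type*} [Fintype S] {ι : Type*} [Fintype ι] [LinearOrder ι]
variable (T : ι → Equiv.Perm S)

/-- At the TRIVIAL background `U ≡ 1` the transport disappears: `(D_μ f)(x) = f(x + e_μ) − f(x)`. -/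
example (μ : ι) (f : S → 𝔸) (x : S) : covD T (fun _ _ => (1 : 𝔸ˣ)) μ f x = f (T μ x) - f x := by
  simp [covD]

/-- … and `(D*_μ G)(x) = G(x − e_μ) − G(x)`. -/
example (μ : ι) (G : S → 𝔸) (x : S) : covDstar T (fun _ _ => (1 : 𝔸ˣ)) μ G x = G ((T μ).symm x) - G x := by
  simp [covDstar]

/-- With ONE direction there are no positively oriented plaquettes: every plaquette sum is empty. -/
example (g : S → Unit → Unit → ℤ) : ∑ q ∈ posPlaq S Unit, g q.1 q.2.1 q.2.2 = 0 := by
  refine Finset.sum_eq_zero fun q hq => absurd ((mem_posPlaq q).1 hq) ?_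
  rw [Subsingleton.elim q.2.1 q.2.2]
  exact lt_irrefl _

end Examples

end Literature.MathematicalPhysics.QuantumFieldTheory.Balaban1983to89.B9Eq39Adjoint
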